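import Summits.AtomisticToContinuum.HydrodynamicLimit.Theorems.CollisionIsometryCLTCollisionalTransferLocalityDefsC
import Summits.AtomisticToContinuum.HydrodynamicLimit.Theorems.CollisionIsometryCLTCollisionalTransferLocalityBlockFields
import Summits.AtomisticToContinuum.HydrodynamicLimit.Theorems.InformationPercolationEngineCollisionMomentBoundRung0
import Literature.Analysis.FluidPDE.CollisionalTransfer
import HarnessLib

/-!
# [V] at equilibrium (rung 0): the weighted collision virial is tight under the homogeneous Gibbs law
(line `hemisphere-affine-slaving`, crux `CollisionalTransferLocality`, stmt-AtomisticToContinuum-9518)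

Helper file (`--supports stmt-AtomisticToContinuum-9518`; registered stub `virialBounded_const`) of the line lead (gen 1,
seat c2). The open stub [V] `stub_virialBounded` asks for tightness of the weighted collision virials
`V_N(t) = (N+1)⁻¹ Σ_{ordered collisions in (0,t]} ε_N ‖Δv_i‖ (1 + ‖v_i‖ + ‖v_j‖)` under the LOCAL Gibbs laws of nice profiles
(an a-priori statement about the non-equilibrium collision flux of deterministic hard spheres, nobody's theorem). This file
PROVES its constant-profile instance: under the flow-invariant homogeneous Gibbs law `G_N = localGibbsLaw σ a u θ N Φ_N`
(`a, θ > 0`), for `0 < σ < σ₀`, every flow family and every `t > 0`, `(V_N(t))_N` is tight (`VirialBounded`).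

* `norm_dV_le` — `‖Δv_i‖ ≤ ‖v_i − v_j‖` (Cauchy–Schwarz in the reflection law);
* `virialK_le_three_mul` — `virialK ≤ 3 ε_N (1 + ‖v_i‖² + ‖v_j‖²)`;
* `virialBounded_const` (registered) — Markov on the mean collision-flux bound of the dilute hard-sphere gas: the landed
  `CollisionMomentBound.collisionMomentBound_const` (route `InformationPercolationEngine`, rung 0, mark `1 + ‖v‖² + ‖w‖²`;
  Cercignani–Illner–Pulvirenti 1994 App. 4.A collision-flux window bound, Ruelle pair bound at small reduced density,
  invariance of `G_N`) dominates `V_N(t) ≤ 3 K_c` on the good set (contact-pair sums as double sums, `(0,t] ⊆ [0,t]`).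
What is NOT proved and why: the non-constant-profile statement [V] itself — the only comparison of a local Gibbs law with the
invariant law costs `Λ^{N+1}` (relative entropy of order `N`) and would need speed-`N` large-deviation upper bounds for the
equilibrium collision flux (same wall as the memos on `JParityClosure.CollisionTightness` / `LambertianContactSwap.CollisionMomentBound`).
-/

namespace Summit.AtomisticToContinuum.HydrodynamicLimit.Theorems.HemisphereAffineSlaving

open scoped BigOperators Topology Classical ENNReal InnerProductSpace
open Filter Set Function MeasureTheory
open Literature.Analysis.FluidPDE

noncomputable section

open Literature.MathematicalPhysics.KineticTheory (T3 V3 hsDiameter hsDiameter_pos localGibbsLaw)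

/-! ## The rung -/

/-- The velocity jump is at most the relative speed: `‖Δv_i‖ ≤ ‖v_i − v_j‖` (Cauchy–Schwarz in the reflection law). -/
theorem norm_dV_le (N : ℕ) (w : Cfg N) (i j : Fin (N + 1)) : ‖dV N w i j‖ ≤ ‖(w i).2 - (w j).2‖ := by
  set n : V3 := (Torus.geometry (Fin 3)).sepVec (w i).1 (w j).1 with hn
  have hdv : dV N w i j = (⟪(w i).2 - (w j).2, n⟫_ℝ / ‖n‖ ^ 2) • n := by
    simp only [dV, reflectVel, ← hn]
    abel_nf
  by_cases h0 : n = 0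
  · rw [hdv, h0, smul_zero, norm_zero]; exact norm_nonneg _
  have hnpos : 0 < ‖n‖ := norm_pos_iff.2 h0
  rw [hdv, norm_smul, Real.norm_eq_abs, abs_div, abs_of_pos (pow_pos hnpos 2), div_mul_eq_mul_div,
    div_le_iff₀ (pow_pos hnpos 2)]
  calc |⟪(w i).2 - (w j).2, n⟫_ℝ| * ‖n‖ ≤ ‖(w i).2 - (w j).2‖ * ‖n‖ * ‖n‖ :=
        mul_le_mul_of_nonneg_right (abs_real_inner_le_norm _ _) hnpos.le
    _ = ‖(w i).2 - (w j).2‖ * ‖n‖ ^ 2 := by ring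

/-- The weighted virial kernel is dominated by `3 ε_N (1 + ‖v_i‖² + ‖v_j‖²)`. -/
theorem virialK_le_three_mul {σ : ℝ} (hσ : 0 < σ) (N : ℕ) (s : ℝ) (w : Cfg N) (i j : Fin (N + 1)) :
    virialK σ N s w i j ≤ hsDiameter σ N * (3 * (1 + ‖(w i).2‖ ^ 2 + ‖(w j).2‖ ^ 2)) := by
  unfold virialK
  have hε := hsDiameter_pos hσ N
  rw [mul_assoc]
  refine mul_le_mul_of_nonneg_left ?_ hε.le
  have h1 : ‖dV N w i j‖ ≤ ‖(w i).2‖ + ‖(w j).2‖ := (norm_dV_le N w i j).trans (norm_sub_le _ _)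
  set a := ‖(w i).2‖
  set b := ‖(w j).2‖
  have ha : 0 ≤ a := norm_nonneg _
  have hb : 0 ≤ b := norm_nonneg _
  calc ‖dV N w i j‖ * (1 + a + b) ≤ (a + b) * (1 + a + b) := mul_le_mul_of_nonneg_right h1 (by positivity)
    _ ≤ 3 * (1 + a ^ 2 + b ^ 2) := by nlinarith [sq_nonneg (a - b), sq_nonneg (a + b - 1)]

/-- **[V] AT EQUILIBRIUM (rung 0).** Under the flow-invariant homogeneous Gibbs law (constant profiles `a, θ > 0`, `u`)
there is `σ₀ > 0` such that for `0 < σ < σ₀`, every flow family and every `t > 0` the weighted collision virials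
`V_N(t)` are tight (`VirialBounded`) — Markov's inequality on the mean collision-flux bound of the dilute hard-sphere
gas (`CollisionMomentBound.collisionMomentBound_const` for the mark `1 + ‖v‖² + ‖w‖²`, which dominates the virial
kernel: `virialK ≤ 3 ε_N (1 + ‖v_i‖² + ‖v_j‖²)`). -/
theorem virialBounded_const : ∀ {a θ : ℝ}, 0 < a → 0 < θ → ∀ u : V3, ∃ σ₀ : ℝ, 0 < σ₀ ∧ ∀ σ : ℝ, 0 < σ → σ < σ₀ → ∀ (Φ : Flows σ) (t : ℝ), 0 < t → VirialBounded σ (fun _ => a) (fun _ => θ) (fun _ => u) Φ t := by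
  intro a θ ha hθ u
  obtain ⟨σ₀, hσ₀, H⟩ := CollisionMomentBound.collisionMomentBound_const ha hθ u
  refine ⟨σ₀, hσ₀, fun σ hσ hσlt Φ t ht δ hδ => ?_⟩
  obtain ⟨Kb, N₀, HN⟩ := H σ hσ hσlt Φ t ht δ hδ
  refine ⟨3 * Kb, eventually_atTop.2 ⟨N₀, fun N hN => ?_⟩⟩
  have hε : 0 < hsDiameter σ N := hsDiameter_pos hσ N
  set P := localGibbsLaw σ (fun _ => a) (fun _ => u) (fun _ => θ) N (Φ N) with hP
  -- the double-sum collision functional of the landed rung-0 bound (its `let`s unfolded)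
  set Kc : Cfg N → ℝ := fun z => hsDiameter σ N / (N + 1 : ℝ) *
      ∑ᶠ (s : ℝ) (_ : s ∈ collisionTimes (Torus.geometry (Fin 3)) (hsDiameter σ N) (fun s => (Φ N).flow s z) ∩ Icc 0 t),
        ∑ i : Fin (N + 1), ∑ j : Fin (N + 1),
          (if i ≠ j ∧ ‖(Torus.geometry (Fin 3)).sepVec ((Φ N).flow s z i).1 ((Φ N).flow s z j).1‖ = hsDiameter σ N
            then 1 + ‖((Φ N).flow s z i).2‖ ^ 2 + ‖((Φ N).flow s z j).2‖ ^ 2 else 0) with hKc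
  have hTle : P {z | Kb < Kc z} ≤ ENNReal.ofReal δ := HN N hN
  -- pathwise: on the good set `V_N(t) ≤ 3 · K_c`
  have hsub : {z : Cfg N | 3 * Kb < virialW σ Φ N z t} ⊆ (Φ N).goodᶜ ∪ {z | Kb < Kc z} := by
    intro z hz
    by_cases hgood : z ∈ (Φ N).good
    · refine Or.inr ?_
      have htraj := (Φ N).isTrajectory z hgood
      have hfin := htraj.finite_collisionTimes_inter_Ioc 0 t
      have hfin' : (collisionTimes (Torus.geometry (Fin 3)) (hsDiameter σ N) (fun s => (Φ N).flow s z) ∩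
          Icc 0 t).Finite := htraj.locFinite 0 t
      -- termwise bound at one collision time, contact-pair sum as a double sum
      have hterm : ∀ s, ∑ p ∈ contactPairs (Torus.geometry (Fin 3)) (hsDiameter σ N) ((Φ N).flow s z),
          virialK σ N s ((Φ N).flow s z) p.1 p.2 ≤
          hsDiameter σ N * (3 * ∑ i : Fin (N + 1), ∑ j : Fin (N + 1),
            (if i ≠ j ∧ ‖(Torus.geometry (Fin 3)).sepVec ((Φ N).flow s z i).1 ((Φ N).flow s z j).1‖ = hsDiameter σ N
              then 1 + ‖((Φ N).flow s z i).2‖ ^ 2 + ‖((Φ N).flow s z j).2‖ ^ 2 else 0)) := by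
        intro s
        have h1 : ∑ p ∈ contactPairs (Torus.geometry (Fin 3)) (hsDiameter σ N) ((Φ N).flow s z),
            virialK σ N s ((Φ N).flow s z) p.1 p.2 ≤
            ∑ p ∈ contactPairs (Torus.geometry (Fin 3)) (hsDiameter σ N) ((Φ N).flow s z),
              hsDiameter σ N * (3 * (1 + ‖((Φ N).flow s z p.1).2‖ ^ 2 + ‖((Φ N).flow s z p.2).2‖ ^ 2)) :=
          Finset.sum_le_sum fun p _ => virialK_le_three_mul hσ N s _ p.1 p.2
        refine h1.trans (le_of_eq ?_)
        rw [sum_contactPairs_eq (htraj.mem s) (fun i j =>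
          hsDiameter σ N * (3 * (1 + ‖((Φ N).flow s z i).2‖ ^ 2 + ‖((Φ N).flow s z j).2‖ ^ 2)))]
        simp only [Finset.mul_sum, mul_ite, mul_zero]
      have hV : virialW σ Φ N z t ≤ 3 * Kc z := by
        rw [hKc]
        dsimp only
        unfold virialW HardSphereFlow.collisionPairSum
        rw [collisionPairSum_eq_finset_sum hfin, finsum_mem_eq_finite_toFinset_sum _ hfin']
        have hsum_le : ∑ s ∈ hfin.toFinset, ∑ p ∈ contactPairs (Torus.geometry (Fin 3)) (hsDiameter σ N)
            ((Φ N).flow s z), virialK σ N s ((Φ N).flow s z) p.1 p.2 ≤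
            ∑ s ∈ hfin'.toFinset, hsDiameter σ N * (3 * ∑ i : Fin (N + 1), ∑ j : Fin (N + 1),
              (if i ≠ j ∧ ‖(Torus.geometry (Fin 3)).sepVec ((Φ N).flow s z i).1 ((Φ N).flow s z j).1‖ =
                  hsDiameter σ N
                then 1 + ‖((Φ N).flow s z i).2‖ ^ 2 + ‖((Φ N).flow s z j).2‖ ^ 2 else 0)) := by
          refine (Finset.sum_le_sum fun s _ => hterm s).trans ?_
          refine Finset.sum_le_sum_of_subset_of_nonneg ?_ fun s _ _ => ?_
          · intro s hs
            rw [Set.Finite.mem_toFinset] at hs ⊢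
            exact ⟨hs.1, hs.2.1.le, hs.2.2⟩
          · refine mul_nonneg hε.le (mul_nonneg (by norm_num) (Finset.sum_nonneg fun i _ =>
              Finset.sum_nonneg fun j _ => ?_))
            split_ifs <;> positivity
        calc ((N : ℝ) + 1)⁻¹ * ∑ s ∈ hfin.toFinset, ∑ p ∈ contactPairs (Torus.geometry (Fin 3)) (hsDiameter σ N)
              ((Φ N).flow s z), virialK σ N s ((Φ N).flow s z) p.1 p.2
            ≤ ((N : ℝ) + 1)⁻¹ * ∑ s ∈ hfin'.toFinset, hsDiameter σ N * (3 * ∑ i : Fin (N + 1), ∑ j : Fin (N + 1),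
              (if i ≠ j ∧ ‖(Torus.geometry (Fin 3)).sepVec ((Φ N).flow s z i).1 ((Φ N).flow s z j).1‖ =
                  hsDiameter σ N
                then 1 + ‖((Φ N).flow s z i).2‖ ^ 2 + ‖((Φ N).flow s z j).2‖ ^ 2 else 0)) :=
              mul_le_mul_of_nonneg_left hsum_le (by positivity)
          _ = _ := by rw [← Finset.mul_sum, ← Finset.mul_sum]; ring
      have h3 : 3 * Kb < 3 * Kc z := lt_of_lt_of_le hz hV
      exact lt_of_mul_lt_mul_left h3 (by norm_num)
    · exact Or.inl hgood
  have hgood0 : P (Φ N).goodᶜ = 0 := localGibbsLaw_compl_good' (Φ N)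
  calc P {z | 3 * Kb < virialW σ Φ N z t} ≤ P ((Φ N).goodᶜ ∪ {z | Kb < Kc z}) := measure_mono hsub
    _ ≤ P (Φ N).goodᶜ + P {z | Kb < Kc z} := measure_union_le _ _
    _ ≤ ENNReal.ofReal δ := by rw [hgood0, zero_add]; exact hTle

end

end Summit.AtomisticToContinuum.HydrodynamicLimit.Theorems.HemisphereAffineSlaving
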